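import Literature.NumberTheory.EllipticCurves.BSDSelmerPConverse
import Literature.NumberTheory.EllipticCurves.StrictSelmerRankOne
import Literature.NumberTheory.EllipticCurves.PAdicBSDKatoFiniteProofs
import HarnessLib

/-!
# The `p`-converse in rank one with no conductor hypothesis: Kim 2022, Cor. 1.4 (proof architecture)

Family `bsd`, companion to `Literature.NumberTheory.EllipticCurves.BSDSelmer` (bsd.S25) and to
`Literature.NumberTheory.EllipticCurves.BSDSelmerPConverse` (the same service for
Burungale–Skinner–Tian–Wan, Thm. 1.10). The named fact
`kim_analyticRank_eq_one_of_mordellWeilRank_eq_one` (C.-H. Kim, *On the soft `p`-converse to a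
theorem of Gross–Zagier and Kolyvagin*, Math. Ann. 387 (2023), 1961–1968 (online 2022) = arXiv:2109.12344,
**Cor. 1.4**: for `E/ℚ` non-CM, `rk_ℤ E(ℚ) = 1` and `#Ш(E/ℚ)[p^∞] < ∞` for one good ordinary prime
`p > 3` with `E[p]` irreducible `⟹ ord_{s=1} L(E, s) = 1`, and in particular `#Ш(E/ℚ) < ∞`) is
deep. The printed deduction (§1 and §2 of the source; chunks 3 and 5–6 of the held text
`paper:arxiv-2109.12344` = arXiv v1; numbering of v1 — journal concordance in § "Text versions" below) is:

* **Cor. 1.4 ⇐ Cor. 1.2.** §1, the sentence introducing Cor. 1.4: "Since Assumption (res) holds if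
  we further assume `#Ш(E/ℚ)[p^∞] < ∞` in Corollary 1.2, we obtain the following statement" —
  with `rk_ℤ E(ℚ) = 1` and `#Ш(E/ℚ)[p^∞] < ∞` giving (cork1) `corank_{ℤ_p} Sel(ℚ, E[p^∞]) = 1 + 0`
  through `0 → E(ℚ) ⊗ ℚ_p/ℤ_p → Sel(ℚ, E[p^∞]) → Ш(E/ℚ)[p^∞] → 0`;
* **Cor. 1.2 ⇐ Thm. 1.1 + Remark 2.6**: for `p ≥ 5` good ordinary with `E[p]` irreducible the
  Iwasawa main conjecture inverting `p` (IMC[`1/p`], Assumption 2.5, à la Kato: `char_Λ(H¹_Iw(ℚ,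
  T)/Λ z_Kato^∞) = char_Λ(Sel_0(ℚ_∞, E[p^∞])^∨)` in `Λ ⊗ ℚ_p`) holds by Kato, Skinner–Urban and
  X. Wan;
* **Thm. 1.1**, proved in §2 from: Thm. 2.1/Cor. 2.3 (Bertolini–Darmon–Venerucci, Perrin-Riou's
  conjecture: for `p` odd, `p² ∤ N`, `L(E, 1) = 0`: `ord_{s=1} L(E, s) = 1 ⟺ res_p(z_Kato) ≠ 0`);
  Thm. 2.4 (Kato: `L(E, 1) ≠ 0 ⟹ Sel(ℚ, E[p^∞])` finite — its only role is to remove the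
  assumption `L(E, 1) = 0` of Thm. 2.1); Prop. 2.7 (under IMC[`1/p`] and `E[p]` irreducible:
  `z_Kato ≠ 0 ⟺ Sel_0(ℚ, E[p^∞])` finite, by Kurihara's control theorem for the `p`-strict Selmer
  group); Prop. 2.8 (under (cork1): `z_Kato ≠ 0 ⟹ res_p(z_Kato) ≠ 0`); Prop. 2.10 ((cork1) and (res)
  `⟹ Sel_0(ℚ, E[p^∞])` finite); and Remark 2.11: "Assumption (res) is crucially and only used in
  Proposition 2.10";
* the "in particular" clauses (`rk_ℤ E(ℚ) = 1`, `#Ш(E/ℚ) < ∞`) "from the work of Gross–Zagier and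
  Kolyvagin with a choice of a suitable imaginary quadratic field" (§2, after Prop. 2.10).

Here `Sel_0(ℚ, E[p^∞]) ⊆ Sel(ℚ, E[p^∞])` is the `p`-strict Selmer group (classes that moreover
vanish in `H¹(ℚ_p, E[p^∞])`), `V = T_p E ⊗ ℚ_p`, `Sel(ℚ, V)` its Bloch–Kato Selmer group, and (res)
is "the restriction map `res_p : Sel(ℚ, V) → E(ℚ_p) ⊗ ℚ_p` is an isomorphism".

This file **proves** the printed deductions, with the one genuinely deep input carried as an
explicit hypothesis and no named fact introduced (D-0026):

* `hcore` — the **core of Thm. 1.1 in the setting of Cor. 1.2** (Cor. 2.3 + Props. 2.7, 2.8 +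
  Remark 2.6, i.e. §2 minus Kato's Thm. 2.4 and minus Prop. 2.10): for `E` non-CM, `p > 3` good
  ordinary, `E[p]` irreducible, `L(E, 1) = 0`, (cork1) and `Sel_0(ℚ, E[p^∞])` finite,
  `ord_{s=1} L(E, s) = 1` — Kato's Euler system and explicit reciprocity law, IMC[`1/p`]
  (Kato, Skinner–Urban, Wan) and Bertolini–Darmon–Venerucci; stated inline, verbatim, in
  `analyticRank_eq_one_of_selmerCorank_eq_one_of_kimCore` and
  `kim_analyticRank_eq_one_of_mordellWeilRank_eq_one_of_kimCore`;
* `analyticRank_eq_one_of_selmerCorank_eq_one_of_kimCore` — **Cor. 1.2** (with (res) transcribed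
  by its `p^∞`-avatar "`Sel_0(ℚ, E[p^∞])` finite", see the design notes, and all three printed
  conclusions) from `hcore`, Kato's finiteness theorem (tree fact `kato_finite_of_L_one_ne_zero`,
  Kato 2004, Thm. 14.2 = Thm. 2.4 of the source) and Gross–Zagier–Kolyvagin (tree fact
  `rank_eq_analyticRank_of_analyticRank_le_one`, Darmon 2004, Thm. 3.22);
* `kim_analyticRank_eq_one_of_mordellWeilRank_eq_one_of_kimCore` — **Cor. 1.4**, i.e. the bsd.S25
  fact `kim_analyticRank_eq_one_of_mordellWeilRank_eq_one`, from the same three inputs: the step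
  (res) ⇐ `rk_ℤ E(ℚ) = 1 ∧ #Ш(E/ℚ)[p^∞] < ∞` (the sentence before Cor. 1.4, with Prop. 2.10;
  Skinner 2020, §2.2, Lemma `rank1lemma`) is the tree THEOREM
  `finite_strictSelmer_of_mordellWeilRank_eq_one` (`StrictSelmerRankOne`), and (cork1) is the
  proved corank identity `WeierstrassCurve.selmerCorank_eq_mordellWeilRank_add_holds`
  (Greenberg 1999, §1) with `zpCorank_eq_zero_of_finite`.

So the trust base of bsd.S25's Cor. 1.4 is reduced to {core of Thm. 1.1, Kato Thm. 14.2,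
Gross–Zagier–Kolyvagin}, every elementary step being proved in the tree.

* `analyticRank_eq_one_of_selmerCorank_eq_one_of_kimCore_of_gzk`,
  `kim_analyticRank_eq_one_of_mordellWeilRank_eq_one_of_kimCore_of_gzk` — the same two deductions
  with the trust base cut to {core of Thm. 1.1, Gross–Zagier–Kolyvagin}: the instance of Kato's
  Thm. 14.2 that the printed proof consumes (Thm. 2.4 of the source, whose only role is to remove
  the assumption `L(E, 1) = 0` of Thm. 2.1) is implied by Gross–Zagier–Kolyvagin, which the
  deduction uses anyway for the "in particular" clauses — tree THEOREM
  `kato_finite_of_L_one_ne_zero_of_rank_eq_analyticRank` (`PAdicBSDKatoFiniteProofs`: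
  `L(E, 1) ≠ 0 ⇒ ord_{s=1} L(E, s) = 0 ⇒ rk_ℤ E(ℚ) = 0 ∧ #Ш(E/ℚ) < ∞ ⇒ Sel_{p^∞}(E/ℚ)` finite, by
  Mordell–Weil and the `p^∞` Kummer sequence). So
  `kim_analyticRank_eq_one_of_mordellWeilRank_eq_one_holds` is exactly one statement away from
  the tree's bsd.S17: the core of Thm. 1.1.

## Design notes

* **(res) versus `Sel_0(ℚ, E[p^∞])` finite.** The tree has no Bloch–Kato Selmer group of the
  rational Tate module (`Selmer` prelude, module docstring: "Bloch–Kato Selmer groups `H¹_f` are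
  deferred"), so (res) is transcribed by the finiteness of the `p`-strict Selmer group
  `Sel_0(ℚ, E[p^∞]) = Sel_{p^∞}(E/ℚ) ∩ ker (H¹(ℚ, E[p^∞]) → H¹(ℚ_p, E[p^∞]))`, in the tree
  `W.selmerGroupPInfty p ⊓ selmerLocalKerPrimaryTorsion W ℚ_[p] p` — literally the hypothesis
  `hloc` of the interim bsd.S25 statement `analyticRank_eq_one_of_selmerCorank_eq_one`. Under
  (cork1) the two are equivalent *by the source's own arguments*: (res) ⟹ finiteness is Prop. 2.10
  ("`Sel_0(ℚ, V) = 0` by (2.2). Thus `Sel_0(ℚ, E[p^∞])` is finite"), and conversely the proof of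
  Prop. 2.8 ("`Sel_0(ℚ, E[p^∞])` is finite, so `Sel_0(ℚ, V) = 0`. Thus the restriction map `res_p`
  is an isomorphism of one-dimensional `ℚ_p`-vector spaces"); by Remark 2.11 the proof of
  Thm. 1.1 consumes (res) only through Prop. 2.10. So the transcription is neither weaker nor
  stronger than the printed Cor. 1.2.
* `L(E, 1)` is `W.entireLFunction 1` and `ord_{s=1} L(E, s)` is `W.analyticRank`, as in
  `kato_finite_of_L_one_ne_zero` and throughout bsd; `corank_{ℤ_p}` is
  `WeierstrassCurve.selmerCorank`; good ordinary = `HasGoodReductionAtPrime` and `p ∤ a_p`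
  (`frobeniusTrace`, globally minimal model), exactly as in the bsd.S25 statements.
* The core hypothesis keeps all of Cor. 1.2's standing hypotheses (non-CM, `p > 3` good ordinary,
  `E[p]` irreducible) although IMC[`1/p`] is where most of them enter: IMC[`1/p`] à la Kato
  (Assumption 2.5) is not expressible in the tree (no Kato zeta element), so Remark 2.6 is
  folded into it. It is a hypothesis of the theorems below, not a named fact: a provefact seat
  may not grow the debt (D-0026), and the statement is recorded here verbatim for a future split.
* What is NOT here: no statement of Thm. 1.1 with IMC[`1/p`] as an explicit hypothesis, nor of
  Props. 2.7/2.8/Cor. 2.3 separately (they are statements about `z_Kato ∈ H¹(ℚ, V)`); the `p = 3`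
  variant of Remark 1.3 is not covered.

## Text versions (ARM P D-audit, reader bsd-cited-r10, sheet `D-AUDIT-r10-S2.md` sha16 e834568ff3dcc1ae
§A.1 / §D F3; typer bsd-cited-ty4, DOC-DEBT DD-26, 2026-08-27 — statements in this file untouched)

Every quotation and theorem NUMBER in this file is the HELD text `paper:arxiv-2109.12344` = arXiv
**v1** (25 Sep 2021, title "On the `p`-converse …"). The JOURNAL text (Math. Ann. 387 (2023), no. 3-4,
1961–1968, published online 2022, doi 10.1007/s00208-022-02511-8) is arXiv **v3** (2 Nov 2022, "Title
changed. The revision is made following the referee's suggestions"; e-print TeX source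
`strSelmer-kappa-p-converse-revise-2.tex`, 375 lines, sha16 a0140afdc6cc21a6, read by the typer —
copy under `pub/bsd-cited/staging/bsd-cited-ty4/DD26-K22/`; theorem counter reconstructed from it =
the reader's PDF reading and the density cell's concordance `kim_version_concordance.txt`). WHAT
DIFFERS: (i) v3 **Thm. 1.1** is stated for ANY `E/ℚ` and ANY prime `p`: "If (cork1)
`cork_{ℤ_p} Sel(ℚ, E[p^∞]) = 1`, (PRC) Perrin-Riou's conjecture on Kato's zeta elements holds
(Conjecture 2.2), (IMC) the Iwasawa main conjecture (inverting `p`) holds (Conjecture 2.5), and (res)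
the restriction map `res_p : Sel(ℚ, V) → E(ℚ_p) ⊗ ℚ_p` is an isomorphism, then `ord_{s=1} L(E, s)
= 1`. In particular, `rk_ℤ E(ℚ) = 1` and `#Ш(E/ℚ) < ∞`" [v3 TeX L143–L152] — v1's standing "non-CM,
`p > 2` non-additive, `E[p]` irreducible" moved into the inputs Thm. 2.3 / Thm. 2.6; (ii) **Cor. 1.2**
[L156–L165] and **Cor. 1.4** [L175–L178] are v1's WORD FOR WORD (so the statements typed from them
are unaffected), Rem. 1.3 [L166–L173], Rem. 1.5 [L179–L181]; (iii) NUMBERING v1 → v3 (journal):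
Thm. 2.1 (Bertolini–Darmon–Venerucci) → **Thm. 2.3** [L252–L254] "If `E` has semi-stable reduction
at an odd prime `p`, then Conjecture 2.2 is true" (PRC = **Conj. 2.2** [L241–L250]; Rem. 2.4: [BST]
at good `p ≥ 5`); Cor. 2.3 → **Cor. 3.1** [L285–L292]; Thm. 2.4 (finiteness when `L(E,1) ≠ 0`) →
**Thm. 3.2** [L294–L300]; Assumption 2.5 (IMC inverting `p`) → **Conj. 2.5** [L268–L275]; Remark 2.6
→ **Thm. 2.6** [L276–L281] "(Kato, Skinner–Urban, Wan). If `E` has good ordinary reduction at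
`p ≥ 5` and `E[p]` is an irreducible Galois representation, then Conjecture 2.5 is true. Proof. See
[Kat04, Theorem 12.5 and Theorem 17.4], [SU14, Theorem 3.33], and [Wan15, Theorem 4]"; Props. 2.7 +
2.8 → **Prop. 3.3** [L302–L347] (TFAE: `Sel_0(ℚ, E[p^∞])` finite / `z_Kato ≠ 0` / `res_p(z_Kato) ≠ 0`,
under (IMC) and (cork1)); Prop. 2.10 → **Lemma 3.5** [L352–L358]; Remark 2.11 → **Rem. 3.4**
[L348–L350] "Although (2) ⇒ (3) immediately follows from Assumption (res), we would like to use
Assumption (res) minimally"; assembly sentence [L359–L361]. The reader's informational note on the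
(IMC) citation chain at (irr)-not-(sur) images (flag candidate `K22-Thm2.6-IMC@(irr)¬(sur)`, refereed
cover Burungale–Castella–Skinner IMRN 2025 Thm. 1.1.2 (a) = tree fact
`burungale_castella_skinner_charIdeal_eq_padicLFunction`) is the C2 desk's to price (sheet §C.2/F4);
nothing in this file changes with it.

## References

* [Kim2022] C.-H. Kim, *On the soft `p`-converse to a theorem of Gross–Zagier and Kolyvagin*,
  Math. Ann. 387 (2023), 1961–1968 (online 2022), doi:10.1007/s00208-022-02511-8 = arXiv:2109.12344: Thm. 1.1,
  Cor. 1.2, Remark 1.3, Cor. 1.4 (§1); Thm. 2.1, Cor. 2.3, Thm. 2.4, Assumption 2.5, Remark 2.6,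
  Props. 2.7, 2.8, 2.10, Remark 2.11 (§2). Held text `paper:arxiv-2109.12344` (chunks 3, 5, 6).
* [BertoliniDarmonVenerucci2022] M. Bertolini, H. Darmon, R. Venerucci, *Heegner points and
  Beilinson–Kato elements: a conjecture of Perrin-Riou*, Adv. Math. 398 (2022), 108172 (= Thm. 2.1
  of [Kim2022]).
* [Skinner2020] C. Skinner, *A converse to a theorem of Gross, Zagier, and Kolyvagin*, Ann. of
  Math. 191 (2020), 329–354 = arXiv:1405.7294: §2.2 (Lemma `rank1lemma`), §3.
* [Kato2004Asterisque] K. Kato, Astérisque 295 (2004), Thm. 14.2 (= Thm. 2.4 of [Kim2022]).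
* [Darmon2004] H. Darmon, *Rational Points on Modular Elliptic Curves*, CBMS 101 (2004), Thm. 3.22
  (Gross–Zagier–Kolyvagin).
* [Greenberg1999LNM] R. Greenberg, *Iwasawa theory for elliptic curves*, LNM 1716 (1999), §1
  (corank identity).
-/

noncomputable section

open scoped Classical

open WeierstrassCurve

namespace Literature.NumberTheory.EllipticCurves

/-! ### Cor. 1.2 from the core of Thm. 1.1, Kato and Gross–Zagier–Kolyvagin -/

/-- **Kim 2022, Cor. 1.2 along its printed proof.** Printed statement (C.-H. Kim, Math. Ann. 387
(2023) = arXiv v3, Cor. 1.2 [v3 TeX L156–L165] — identical word for word in the held arXiv v1, whose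
numbering this docstring uses: Cor. 1.2 = Thm. 1.1 + Remark 2.6 (journal: Thm. 1.1 ∘ Thm. 2.3 ∘
Thm. 2.6; concordance in the module docstring "Text versions")): "Let `E` be a non-CM elliptic curve over `ℚ` and `p > 3`
a good ordinary prime for `E`. Assume that `E[p]` is an irreducible mod `p` Galois representation.
If (cork1) `cork_{ℤ_p} Sel(ℚ, E[p^∞]) = 1`, and (res) the restriction map
`res_p : Sel(ℚ, V) → E(ℚ_p) ⊗ ℚ_p` is an isomorphism, then `ord_{s=1} L(E, s) = 1`. In particular,
`rk_ℤ E(ℚ) = 1` and `#Ш(E/ℚ) < ∞`." Transcription (globally minimal model `W`): non-CM =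
`¬ W.HasCM`; good ordinary `p > 3` = `3 < p`, `hgood`, `hord : p ∤ a_p(E)`; `E[p]` irreducible =
`hirr`; (cork1) = `W.selmerCorank p = 1`; (res) by its `p^∞`-avatar, the finiteness of the
`p`-strict Selmer group `Sel_0(ℚ, E[p^∞]) = Sel_{p^∞}(E/ℚ) ∩ ker (H¹(ℚ, E[p^∞]) → H¹(ℚ_p, E[p^∞]))`
(`hres`; equivalent to (res) under (cork1) by the source's Prop. 2.10 and the proof of its
Prop. 2.8, and consumed only through Prop. 2.10 by Remark 2.11 — module docstring); all three
printed conclusions. Hypotheses: the core of Thm. 1.1 (`hcore`: Cor. 2.3 from Thm. 2.1 =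
Bertolini–Darmon–Venerucci, Props. 2.7–2.8 under IMC[`1/p`], Remark 2.6 — for `E` non-CM, `p > 3`
good ordinary, `E[p]` irreducible, `L(E, 1) = 0`, (cork1), `Sel_0(ℚ, E[p^∞])` finite:
`ord_{s=1} L(E, s) = 1`; printed pieces: Cor. 2.3 "Under the setting of Theorem 2.1 [`p` odd,
`p² ∤ N`, `L(E, 1) = 0`], the following statements are equivalent. (1) `ord_{s=1} L(E, s) = 1`. (2)
`P` has infinite order. (3) `res_p(z_Kato)` is non-zero."; Prop. 2.7 "… `E[p]` irreducible and the
Iwasawa main conjecture inverting `p` holds. Then the following are equivalent. (1) `z_Kato` is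
non-zero. (2) `Sel_0(ℚ, E[p^∞])` is finite."; Prop. 2.8 "… and `cork_{ℤ_p} Sel(ℚ, E[p^∞]) = 1`.
Then … (1) `z_Kato` is non-zero. (2) `res_p(z_Kato)` is non-zero."; Remark 2.6 "When `p ≥ 5` is good
ordinary for `E` and `E[p]` is an irreducible Galois representation, Assumption 2.5 follows from the
work of Kato, Skinner–Urban, and X. Wan."), Kato's finiteness theorem (`hKato`, tree fact
`kato_finite_of_L_one_ne_zero`: `L(E, 1) ≠ 0 ⟹ Sel_{p^∞}(E/ℚ)` finite — Thm. 2.4 of the source: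
"Although the `L(E, 1) = 0` assumption is incorporated in Theorem 2.1, it can be removed in our
main result thanks to the following theorem [Kato]") and Gross–Zagier–Kolyvagin (`hGZK`, tree
fact `rank_eq_analyticRank_of_analyticRank_le_one`: `ord_{s=1} L(E, s) ≤ 1 ⟹ rk = ord ∧ #Ш < ∞`
— "The last 'In particular' part follows from the work of Gross–Zagier and Kolyvagin", §2).
Proof, as printed: if `L(E, 1) ≠ 0` then `Sel_{p^∞}(E/ℚ)` is finite (Kato), of corank `0`
(`selmerCorank_eq_zero_of_finite`), contradicting (cork1); so `L(E, 1) = 0` and the core gives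
`ord_{s=1} L(E, s) = 1`, whence `rk_ℤ E(ℚ) = 1` and `#Ш(E/ℚ) < ∞` by Gross–Zagier–Kolyvagin.
[cite: Kim2022, Cor. 1.2 and the proof of Thm. 1.1 (arXiv v1 §2: Cor. 2.3, Thm. 2.4, Props. 2.7–2.8, 2.10, Remarks 2.6, 2.11 = journal/arXiv v3 §§2–3: Cor. 3.1, Thm. 3.2, Prop. 3.3, Lemma 3.5, Thm. 2.6, Rem. 3.4; v3 TeX L156–L165, L276–L361)] -/
theorem analyticRank_eq_one_of_selmerCorank_eq_one_of_kimCore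
    (hcore : ∀ (W : WeierstrassCurve ℚ) [W.IsElliptic] [W.IsGloballyMinimal], ¬ W.HasCM →
      ∀ (p : ℕ) [Fact p.Prime], 3 < p → W.HasGoodReductionAtPrime p →
      ¬ (p : ℤ) ∣ W.frobeniusTrace p → W.HasIrreducibleModPGaloisRep p →
      W.entireLFunction 1 = 0 → W.selmerCorank p = 1 →
      Finite ↥(W.selmerGroupPInfty p ⊓ selmerLocalKerPrimaryTorsion W ℚ_[p] p) →
      W.analyticRank = 1)
    (hKato : ∀ (W : WeierstrassCurve ℚ) [W.IsElliptic] (p : ℕ) [Fact p.Prime],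
      kato_finite_of_L_one_ne_zero W p)
    (hGZK : rank_eq_analyticRank_of_analyticRank_le_one)
    (W : WeierstrassCurve ℚ) [W.IsElliptic] [W.IsGloballyMinimal] (hcm : ¬ W.HasCM) (p : ℕ)
    [Fact p.Prime] (hp : 3 < p) (hgood : W.HasGoodReductionAtPrime p)
    (hord : ¬ (p : ℤ) ∣ W.frobeniusTrace p) (hirr : W.HasIrreducibleModPGaloisRep p)
    (hcork : W.selmerCorank p = 1)
    (hres : Finite ↥(W.selmerGroupPInfty p ⊓ selmerLocalKerPrimaryTorsion W ℚ_[p] p)) :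
    W.analyticRank = 1 ∧ W.mordellWeilRank = 1 ∧ Finite W.sha := by
  -- Thm. 2.4 (Kato): `L(E, 1) = 0`, for otherwise `Sel_{p^∞}(E/ℚ)` is finite, of corank `0 ≠ 1`
  have hL : W.entireLFunction 1 = 0 := by
    by_contra hL
    obtain ⟨-, -, hfin⟩ := hKato W p hL
    haveI := hfin
    have h0 : W.selmerCorank p = 0 := W.selmerCorank_eq_zero_of_finite p
    omega
  -- Cor. 2.3 + Props. 2.7, 2.8 (+ Remark 2.6)
  have han : W.analyticRank = 1 := hcore W hcm p hp hgood hord hirr hL hcork hres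
  -- "In particular": Gross–Zagier–Kolyvagin
  obtain ⟨hrk, hsha⟩ := hGZK W han.le
  exact ⟨han, hrk.trans han, hsha⟩

/-! ### Cor. 1.4 = bsd.S25 `kim_analyticRank_eq_one_of_mordellWeilRank_eq_one` -/

/-- **Kim 2022, Cor. 1.4 along its printed proof** ("Since Assumption (res) holds if we further
assume `#Ш(E/ℚ)[p^∞] < ∞` in Corollary 1.2, we obtain the following statement. Corollary 1.4 …",
§1): the bsd.S25 named fact `kim_analyticRank_eq_one_of_mordellWeilRank_eq_one` from the core of
Thm. 1.1 (`hcore`, as in `analyticRank_eq_one_of_selmerCorank_eq_one_of_kimCore`), Kato's finiteness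
theorem (`hKato`, tree fact `kato_finite_of_L_one_ne_zero`) and Gross–Zagier–Kolyvagin (`hGZK`,
tree fact `rank_eq_analyticRank_of_analyticRank_le_one`). The two steps special to Cor. 1.4 are
theorems of the tree: (cork1) from `rk_ℤ E(ℚ) = 1` and `#Ш(E/ℚ)[p^∞] < ∞` by the corank identity
`corank_{ℤ_p} Sel_{p^∞}(E/ℚ) = rk_ℤ E(ℚ) + corank_{ℤ_p} Ш(E/ℚ)[p^∞]`
(`WeierstrassCurve.selmerCorank_eq_mordellWeilRank_add_holds`, Greenberg 1999, §1) `= 1 + 0`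
(`zpCorank_eq_zero_of_finite`); and (res) in `p^∞`-form, the finiteness of `Sel_0(ℚ, E[p^∞])`, by
`finite_strictSelmer_of_mordellWeilRank_eq_one` (`StrictSelmerRankOne`; Kim §1 with Prop. 2.10,
Skinner 2020, §2.2, Lemma `rank1lemma`). Then Cor. 1.2
(`analyticRank_eq_one_of_selmerCorank_eq_one_of_kimCore`) gives both printed conclusions
`ord_{s=1} L(E, s) = 1` and `#Ш(E/ℚ) < ∞`.
[cite: Kim2022, Cor. 1.4 (deduction from Cor. 1.2, §1; v3 TeX L174–L178) and the proof of Thm. 1.1 (arXiv v1 §2 = journal §§2–3)] -/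
theorem kim_analyticRank_eq_one_of_mordellWeilRank_eq_one_of_kimCore
    (hcore : ∀ (W : WeierstrassCurve ℚ) [W.IsElliptic] [W.IsGloballyMinimal], ¬ W.HasCM →
      ∀ (p : ℕ) [Fact p.Prime], 3 < p → W.HasGoodReductionAtPrime p →
      ¬ (p : ℤ) ∣ W.frobeniusTrace p → W.HasIrreducibleModPGaloisRep p →
      W.entireLFunction 1 = 0 → W.selmerCorank p = 1 →
      Finite ↥(W.selmerGroupPInfty p ⊓ selmerLocalKerPrimaryTorsion W ℚ_[p] p) →
      W.analyticRank = 1)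
    (hKato : ∀ (W : WeierstrassCurve ℚ) [W.IsElliptic] (p : ℕ) [Fact p.Prime],
      kato_finite_of_L_one_ne_zero W p)
    (hGZK : rank_eq_analyticRank_of_analyticRank_le_one) :
    kim_analyticRank_eq_one_of_mordellWeilRank_eq_one := by
  intro W _ _ hcm p _ hp hgood hord hirr hrank hsha
  haveI := hsha
  -- (cork1): `corank Sel_{p^∞} = rk + corank Ш[p^∞] = 1 + 0`
  have h0 : W.shaCorank p = 0 := zpCorank_eq_zero_of_finite _ p
  have hcork : W.selmerCorank p = 1 := by
    rw [W.selmerCorank_eq_mordellWeilRank_add_holds p, hrank, h0]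
  -- (res) in `p^∞`-form: the rank-one strict-Selmer lemma (proved)
  have hres : Finite ↥(W.selmerGroupPInfty p ⊓ selmerLocalKerPrimaryTorsion W ℚ_[p] p) :=
    finite_strictSelmer_of_mordellWeilRank_eq_one W p hrank
  -- Cor. 1.2
  obtain ⟨han, -, hfin⟩ := analyticRank_eq_one_of_selmerCorank_eq_one_of_kimCore hcore hKato hGZK
    W hcm p hp hgood hord hirr hcork hres
  exact ⟨han, hfin⟩

/-! ### Trust base {core of Thm. 1.1, Gross–Zagier–Kolyvagin}: Kato's Thm. 2.4 through bsd.S17 -/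

/-- **Kim 2022, Cor. 1.2 from the core of Thm. 1.1 and Gross–Zagier–Kolyvagin alone.** In
`analyticRank_eq_one_of_selmerCorank_eq_one_of_kimCore` the input "Kato's finiteness theorem"
(`hKato`, Thm. 2.4 of the source = Kato 2004, Thm. 14.2, tree fact `kato_finite_of_L_one_ne_zero`;
in the printed proof its only role is to remove the assumption `L(E, 1) = 0` of Thm. 2.1:
"Although the `L(E, 1) = 0` assumption is incorporated in Theorem 2.1, it can be removed in our
main result thanks to the following theorem") is a consequence of Gross–Zagier–Kolyvagin
(`hGZK`, tree fact `rank_eq_analyticRank_of_analyticRank_le_one`, bsd.S17), which the deduction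
uses anyway for the "in particular" clauses: tree theorem
`kato_finite_of_L_one_ne_zero_of_rank_eq_analyticRank` (`L(E, 1) ≠ 0 ⇒ ord_{s=1} L(E, s) = 0 ⇒
rk_ℤ E(ℚ) = 0 ∧ #Ш(E/ℚ) < ∞ ⇒ E(ℚ)`, `Ш(E/ℚ)[p^∞]`, `Sel_{p^∞}(E/ℚ)` finite). So Cor. 1.2 (in the
transcription of `analyticRank_eq_one_of_selmerCorank_eq_one_of_kimCore`) follows from the core of
Thm. 1.1 (`hcore`, verbatim as there) and bsd.S17.
[cite: Kim2022, Cor. 1.2 and the proof of Thm. 1.1 (arXiv v1 Thm. 2.4 = journal Thm. 3.2, v3 TeX L294–L300)] -/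
theorem analyticRank_eq_one_of_selmerCorank_eq_one_of_kimCore_of_gzk
    (hcore : ∀ (W : WeierstrassCurve ℚ) [W.IsElliptic] [W.IsGloballyMinimal], ¬ W.HasCM →
      ∀ (p : ℕ) [Fact p.Prime], 3 < p → W.HasGoodReductionAtPrime p →
      ¬ (p : ℤ) ∣ W.frobeniusTrace p → W.HasIrreducibleModPGaloisRep p →
      W.entireLFunction 1 = 0 → W.selmerCorank p = 1 →
      Finite ↥(W.selmerGroupPInfty p ⊓ selmerLocalKerPrimaryTorsion W ℚ_[p] p) →
      W.analyticRank = 1)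
    (hGZK : rank_eq_analyticRank_of_analyticRank_le_one)
    (W : WeierstrassCurve ℚ) [W.IsElliptic] [W.IsGloballyMinimal] (hcm : ¬ W.HasCM) (p : ℕ)
    [Fact p.Prime] (hp : 3 < p) (hgood : W.HasGoodReductionAtPrime p)
    (hord : ¬ (p : ℤ) ∣ W.frobeniusTrace p) (hirr : W.HasIrreducibleModPGaloisRep p)
    (hcork : W.selmerCorank p = 1)
    (hres : Finite ↥(W.selmerGroupPInfty p ⊓ selmerLocalKerPrimaryTorsion W ℚ_[p] p)) :
    W.analyticRank = 1 ∧ W.mordellWeilRank = 1 ∧ Finite W.sha :=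
  analyticRank_eq_one_of_selmerCorank_eq_one_of_kimCore hcore
    (fun W _ p _ ↦ kato_finite_of_L_one_ne_zero_of_rank_eq_analyticRank W p hGZK) hGZK
    W hcm p hp hgood hord hirr hcork hres

/-- **Kim 2022, Cor. 1.4 (bsd.S25 `kim_analyticRank_eq_one_of_mordellWeilRank_eq_one`) from the
core of Thm. 1.1 and Gross–Zagier–Kolyvagin alone**: as
`kim_analyticRank_eq_one_of_mordellWeilRank_eq_one_of_kimCore`, with its input Kato's finiteness
theorem (Thm. 2.4 of the source, tree fact `kato_finite_of_L_one_ne_zero`) supplied from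
Gross–Zagier–Kolyvagin (`hGZK`, bsd.S17) by the tree theorem
`kato_finite_of_L_one_ne_zero_of_rank_eq_analyticRank`. This cuts the trust base of the named
fact to {core of Thm. 1.1 (`hcore`: Kato's Euler system, IMC[`1/p`], Bertolini–Darmon–Venerucci),
bsd.S17}: `kim_analyticRank_eq_one_of_mordellWeilRank_eq_one_holds` is this theorem applied to a
proof of `hcore` and to `rank_eq_analyticRank_of_analyticRank_le_one`.
[cite: Kim2022, Cor. 1.4 (deduction from Cor. 1.2, §1) and arXiv v1 Thm. 2.4 = journal Thm. 3.2 (v3 TeX L174–L178, L294–L300)] -/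
theorem kim_analyticRank_eq_one_of_mordellWeilRank_eq_one_of_kimCore_of_gzk
    (hcore : ∀ (W : WeierstrassCurve ℚ) [W.IsElliptic] [W.IsGloballyMinimal], ¬ W.HasCM →
      ∀ (p : ℕ) [Fact p.Prime], 3 < p → W.HasGoodReductionAtPrime p →
      ¬ (p : ℤ) ∣ W.frobeniusTrace p → W.HasIrreducibleModPGaloisRep p →
      W.entireLFunction 1 = 0 → W.selmerCorank p = 1 →
      Finite ↥(W.selmerGroupPInfty p ⊓ selmerLocalKerPrimaryTorsion W ℚ_[p] p) →
      W.analyticRank = 1)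
    (hGZK : rank_eq_analyticRank_of_analyticRank_le_one) :
    kim_analyticRank_eq_one_of_mordellWeilRank_eq_one :=
  kim_analyticRank_eq_one_of_mordellWeilRank_eq_one_of_kimCore hcore
    (fun W _ p _ ↦ kato_finite_of_L_one_ne_zero_of_rank_eq_analyticRank W p hGZK) hGZK

end Literature.NumberTheory.EllipticCurves

end
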